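import Summits.NavierStokesRegularity.NavierStokesRegularity.Theses.PalasekTowerBreakdown
import Summits.NavierStokesRegularity.FluidComputer.PalasekTowerRegisterGlobalCoreFloorsAt

/-!
# NavierStokesRegularity — route `PalasekTowerBreakdown`: the first rung `HeredityAtOne` read through the
# Kelvin-critical conjunct of its lower stub — necessary readout numbers and refutation templates

Supports `stmt-NavierStokesRegularity-19249` (`PalasekTowerBreakdown.HeredityAtOne := HeredityAtOne`;
registered skeleton `Cruxes/HeredityAtOne/Lines/birth.lean`, stubs `stub_continuation_envelope_one :
ContinuationEnvelopeAt 1` / `stub_readout_floors_one : ReadoutFloorsAt 1`). Cell `ns-blowup`, seat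
`ns-blowup-ecbridge-5` (g3) — the `k = 1` reading of the seat's lower-half lemmas for the sibling child
`HeredityFromTwo` (`PalasekTowerBreakdownHeredityFromTwoCoreFloors.lean`). LABEL: E–C typing (glue over
the landed register files `PalasekTowerRegisterGlobalCoreFloors` (p430943) / `…CoreFloorsAt` /
`…HalvesAt` (p422702)). WHAT THIS IS NOT: not NS — no stage, tower or instance is constructed; the
first rung is OPEN and not claimed here; every theorem below has it as hypothesis or concludes its
NEGATION from an explicitly typed witness hypothesis that nobody has instantiated.

* `palasekTowerBreakdown_heredityAtOne_weak_floors`: under the first rung, every finite-energy classical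
  continuation of a registered level-1 stage to `τ₂` inside the ceiling `(5/3) Y₂` shows, at `τ₂` and within
  `radius + 1/N₂` of the origin, speed `≥ Y₂ / (8π)` and strain `≥ A₂ / (8π)` (`c₁ = 1` under rigidity);
* `palasekTowerBreakdown_heredityAtOne_core_circulation_band`: under the first rung every registered level-1
  stage extends to a level-2 stage whose `N₂`-core carries circulation in `[N₂^{3/10}, (40π/3) N₂^{3/10}]`
  (the «`Re_Γ ≤ 42 · N₂^{0.3}`» of the item's why-might-fail is the CAP half, a theorem);
* refutation templates `palasekTowerBreakdown_not_heredityAtOne_of_slow_readout` /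
  `…_of_unstrained_readout`: ONE registered level-1 stage of a pinned rigid quiet wide schedule with ONE
  finite-energy classical continuation to `τ₂` inside `(5/3) Y₂` whose speed (resp. strain) at `τ₂` stays
  below `Y₂ / (8π)` (resp. `A₂ / (8π)`) throughout the ball of radius `radius + 1/N₂` refutes the first rung
  — and with it the parent (`palasekTowerBreakdown_not_episodeInduction_of_slow_first_readout`). No loop
  search is needed to certify such a negative.

References: S. Palasek, arXiv:2605.13827 §3.1, §4 [cite: Palasek2026ElementaryModel, §3–§4];
A. J. Majda, A. L. Bertozzi, *Vorticity and Incompressible Flow*, CUP 2002, §1.6 eq. (1.57)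
[cite: MajdaBertozziCUP2002, §1.6].
-/

-- `Summit.<Summit>.<Problem>` is the tree's mandated summit-side namespace (CONVENTIONS §2); for this
-- single-conjunct summit the two coincide, so the duplicate is deliberate.
set_option linter.dupNamespace false

noncomputable section

namespace Summit.NavierStokesRegularity.NavierStokesRegularity.Theorems

open Set MeasureTheory Real
open scoped ENNReal
open Summit.NavierStokesRegularity.NavierStokesRegularity.Theses
open Summit.NavierStokesRegularity.FluidComputer.PalasekTowerClayBridge
open Literature.Analysis.FluidPDE

/-- **Weak floors at the first hand-over, under the first rung** (`k = 1`; `Y (1+1) = Y₂`, `A (1+1) = A₂`,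
`N (1+1) = N₂`). [cite: Palasek2026ElementaryModel, §4] -/
theorem palasekTowerBreakdown_heredityAtOne_weak_floors (h : PalasekTowerBreakdown.HeredityAtOne) :
    ∀ S : Schedule TowerRates.wide, S.Pins 8 (6 / 5) → S.Rigid → S.Quiet →
    ∀ s : Stage 1 TowerRates.wide S (Margins.routeG TowerRates.wide) 1,
    ∀ (u : ℝ → EuclideanSpace ℝ (Fin 3) → EuclideanSpace ℝ (Fin 3))
      (p : ℝ → EuclideanSpace ℝ (Fin 3) → ℝ),
      IsClassicalNSSolutionOn (Icc 0 (S.τ (1 + 1))) 1 S.f u p →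
      (∀ t ∈ Icc 0 (S.τ 1), u t = s.u t ∧ p t = s.p t) →
      (∃ C : ℝ≥0∞, C < ⊤ ∧ ∀ t ∈ Icc 0 (S.τ (1 + 1)), ∫⁻ x, ‖u t x‖ₑ ^ 2 ≤ C) →
      (∀ t ∈ Icc 0 (S.τ (1 + 1)), ∀ x, ‖u t x‖ ≤ S.c₂ * TowerRates.wide.Y (1 + 1)) →
      (∃ y, ‖y‖ ≤ S.radius + 1 / TowerRates.wide.N (1 + 1) ∧
        S.c₁ * TowerRates.wide.Y (1 + 1) / (8 * π) ≤ ‖u (S.τ (1 + 1)) y‖) ∧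
      (∃ y, ‖y‖ ≤ S.radius + 1 / TowerRates.wide.N (1 + 1) ∧
        S.c₁ * TowerRates.wide.A (1 + 1) / (8 * π) ≤ ‖fderiv ℝ (u (S.τ (1 + 1))) y‖) :=
  HeredityAtOne.weak_floors h

/-- **The circulation band of the first hand-over `1 → 2`, under the first rung.**
[cite: Palasek2026ElementaryModel, §3.1] -/
theorem palasekTowerBreakdown_heredityAtOne_core_circulation_band
    (h : PalasekTowerBreakdown.HeredityAtOne) :
    ∀ S : Schedule TowerRates.wide, S.Pins 8 (6 / 5) → S.Rigid → S.Quiet →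
    ∀ s : Stage 1 TowerRates.wide S (Margins.routeG TowerRates.wide) 1,
    ∃ s' : Stage 1 TowerRates.wide S (Margins.routeG TowerRates.wide) (1 + 1), s.Extends s' ∧
      ∃ (x : EuclideanSpace ℝ (Fin 3)) (γ : ℝ → EuclideanSpace ℝ (Fin 3)),
        ‖x‖ ≤ S.radius ∧ ContDiff ℝ 1 γ ∧ γ 0 = γ 1 ∧
        (∀ σ ∈ Icc (0 : ℝ) 1, γ σ ∈ Metric.closedBall x (1 / TowerRates.wide.N (1 + 1))) ∧
        (∀ σ ∈ Icc (0 : ℝ) 1, ‖deriv γ σ‖ ≤ 8 * π / TowerRates.wide.N (1 + 1)) ∧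
        TowerRates.wide.N (1 + 1) ^ (3 / 10 : ℝ) ≤ circulation (s'.u (S.τ (1 + 1))) γ ∧
        circulation (s'.u (S.τ (1 + 1))) γ ≤ 40 * π / 3 * TowerRates.wide.N (1 + 1) ^ (3 / 10 : ℝ) :=
  HeredityAtOne.core_circulation_band_rigid h

/-- **Refutation template against the first rung (speed)**: a slow readout of ONE registered level-1 stage
refutes `PalasekTowerBreakdown.HeredityAtOne`. [cite: Palasek2026ElementaryModel, §3.1] -/
theorem palasekTowerBreakdown_not_heredityAtOne_of_slow_readout
    (hW : ∃ (S : Schedule TowerRates.wide)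
      (s : Stage 1 TowerRates.wide S (Margins.routeG TowerRates.wide) 1)
      (u : ℝ → EuclideanSpace ℝ (Fin 3) → EuclideanSpace ℝ (Fin 3))
      (p : ℝ → EuclideanSpace ℝ (Fin 3) → ℝ),
      S.Pins 8 (6 / 5) ∧ S.Rigid ∧ S.Quiet ∧
      IsClassicalNSSolutionOn (Icc 0 (S.τ (1 + 1))) 1 S.f u p ∧
      (∀ t ∈ Icc 0 (S.τ 1), u t = s.u t ∧ p t = s.p t) ∧
      (∃ C : ℝ≥0∞, C < ⊤ ∧ ∀ t ∈ Icc 0 (S.τ (1 + 1)), ∫⁻ x, ‖u t x‖ₑ ^ 2 ≤ C) ∧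
      (∀ t ∈ Icc 0 (S.τ (1 + 1)), ∀ x, ‖u t x‖ ≤ S.c₂ * TowerRates.wide.Y (1 + 1)) ∧
      (∀ y, ‖y‖ ≤ S.radius + 1 / TowerRates.wide.N (1 + 1) →
        ‖u (S.τ (1 + 1)) y‖ < S.c₁ * TowerRates.wide.Y (1 + 1) / (8 * π))) :
    ¬ PalasekTowerBreakdown.HeredityAtOne :=
  not_heredityAtOne_of_slow_readout hW

/-- **Refutation template against the first rung (strain)**: an unstrained readout of ONE registered level-1
stage refutes `PalasekTowerBreakdown.HeredityAtOne`. [cite: Palasek2026ElementaryModel, §3.1] -/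
theorem palasekTowerBreakdown_not_heredityAtOne_of_unstrained_readout
    (hW : ∃ (S : Schedule TowerRates.wide)
      (s : Stage 1 TowerRates.wide S (Margins.routeG TowerRates.wide) 1)
      (u : ℝ → EuclideanSpace ℝ (Fin 3) → EuclideanSpace ℝ (Fin 3))
      (p : ℝ → EuclideanSpace ℝ (Fin 3) → ℝ),
      S.Pins 8 (6 / 5) ∧ S.Rigid ∧ S.Quiet ∧
      IsClassicalNSSolutionOn (Icc 0 (S.τ (1 + 1))) 1 S.f u p ∧
      (∀ t ∈ Icc 0 (S.τ 1), u t = s.u t ∧ p t = s.p t) ∧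
      (∃ C : ℝ≥0∞, C < ⊤ ∧ ∀ t ∈ Icc 0 (S.τ (1 + 1)), ∫⁻ x, ‖u t x‖ₑ ^ 2 ≤ C) ∧
      (∀ t ∈ Icc 0 (S.τ (1 + 1)), ∀ x, ‖u t x‖ ≤ S.c₂ * TowerRates.wide.Y (1 + 1)) ∧
      (∀ y, ‖y‖ ≤ S.radius + 1 / TowerRates.wide.N (1 + 1) →
        ‖fderiv ℝ (u (S.τ (1 + 1))) y‖ < S.c₁ * TowerRates.wide.A (1 + 1) / (8 * π))) :
    ¬ PalasekTowerBreakdown.HeredityAtOne :=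
  not_heredityAtOne_of_unstrained_readout hW

/-- **… and the parent falls with the first rung**: a slow first readout refutes
`PalasekTowerBreakdown.EpisodeInduction` (the rung is a truncation of the parent,
`EpisodeInductionG.heredityAtOne`). [cite: Palasek2026ElementaryModel, §4] -/
theorem palasekTowerBreakdown_not_episodeInduction_of_slow_first_readout
    (hW : ∃ (S : Schedule TowerRates.wide)
      (s : Stage 1 TowerRates.wide S (Margins.routeG TowerRates.wide) 1)
      (u : ℝ → EuclideanSpace ℝ (Fin 3) → EuclideanSpace ℝ (Fin 3))
      (p : ℝ → EuclideanSpace ℝ (Fin 3) → ℝ),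
      S.Pins 8 (6 / 5) ∧ S.Rigid ∧ S.Quiet ∧
      IsClassicalNSSolutionOn (Icc 0 (S.τ (1 + 1))) 1 S.f u p ∧
      (∀ t ∈ Icc 0 (S.τ 1), u t = s.u t ∧ p t = s.p t) ∧
      (∃ C : ℝ≥0∞, C < ⊤ ∧ ∀ t ∈ Icc 0 (S.τ (1 + 1)), ∫⁻ x, ‖u t x‖ₑ ^ 2 ≤ C) ∧
      (∀ t ∈ Icc 0 (S.τ (1 + 1)), ∀ x, ‖u t x‖ ≤ S.c₂ * TowerRates.wide.Y (1 + 1)) ∧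
      (∀ y, ‖y‖ ≤ S.radius + 1 / TowerRates.wide.N (1 + 1) →
        ‖u (S.τ (1 + 1)) y‖ < S.c₁ * TowerRates.wide.Y (1 + 1) / (8 * π))) :
    ¬ PalasekTowerBreakdown.EpisodeInduction := fun h =>
  palasekTowerBreakdown_not_heredityAtOne_of_slow_readout hW (EpisodeInductionG.heredityAtOne h)

end Summit.NavierStokesRegularity.NavierStokesRegularity.Theorems

end
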